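import Summits.BirchSwinnertonDyer.BirchSwinnertonDyer.Theses.AdditiveKolyvaginRoad
import Literature.NumberTheory.EllipticCurves.IsogenyPotentiallyGoodMinimalDiscriminantProofs
import HarnessLib

set_option linter.dupNamespace false -- `…BirchSwinnertonDyer.BirchSwinnertonDyer…` is the cell's nested layout (D-0017)
set_option autoImplicit false

/-!
# Item 20708 `DokchitserIsogenyMinimalDiscriminant` (route `AdditiveKolyvaginRoad`, support 9) — Dokchitser–Dokchitser 2015
# Thm. 5.1 (1), clause `ℓ ≠ p` — PROVED BY NAME (LADDER-BSD D-0154 (2), INPUTS-LIST-1 row 2, idle-prover sweep)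

Seat `bsd-inputs-honda-p1` (gen 6, idle INPUTS prover of the desk `pub/bsd-wall/bsd-inputs`), `--workitem` stmt-BirchSwinnertonDyer-20708.
THEOREMS ONLY (no definition, no named fact, no `sorry`).

The item is the named published fact
`Literature.NumberTheory.EllipticCurves.dokchitser_padicValInt_minimalDiscriminantInt_eq_of_isogeny_of_not_dvd_degree` (an isogeny of degree
prime to `p` preserves `v_p(Δ_min)` at a prime of potentially good reduction; Dokchitser–Dokchitser, Trans. AMS 367 (2015), Thm. 5.1 (1)),
which ALREADY HAS its hypothesis-free discharge in the tree:
`Literature.NumberTheory.EllipticCurves.dokchitser_padicValInt_minimalDiscriminantInt_eq_of_isogeny_of_not_dvd_degree_holds`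
(module `Literature/NumberTheory/EllipticCurves/IsogenyPotentiallyGoodMinimalDiscriminantProofs.lean`: potential good reduction over
`ℚ(E[3])` / `ℚ(E[4])`, Silverman *ATAEC* IV.10.3, *AEC* VII.7.2, minimal models at `w`, the two inequalities for `φ` and its dual). The route
item (antecedent 3 of `ManinFrameResidueProperR`, HELD as a cited input) was never re-keyed to it; this leaf file records the discharge against
the route declaration by `unfold; exact`. Found by the desk's «open by-name alias whose fact has a `_holds`» sweep (2026-08-28T11:3xZ).
Nothing is re-derived; no landed declaration is restated.

Honest framing: UNCONDITIONAL (the Literature discharge is a kernel theorem about minimal discriminants under prime-to-`p` isogeny). Closing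
item 20708 removes one displayed print input of `AdditiveKolyvaginRoad` AS TYPED; no crux and no summit statement is proved; the
Birch–Swinnerton-Dyer conjecture is NOT proved by any of this.
References: [DokchitserDokchitser2015LocalInvariants] Thm. 5.1 (1), Table 1; [SilvermanAEC2009] Cor. VII.7.2, Prop. VII.5.5.
-/

namespace Summit.BirchSwinnertonDyer.BirchSwinnertonDyer.Theorems.InputsSweep

/-- **Item 20708 on route `AdditiveKolyvaginRoad` — `DokchitserIsogenyMinimalDiscriminant` PROVED (by name):** Dokchitser–Dokchitser 2015
Thm. 5.1 (1) (`ℓ ≠ p`), from the tree's discharge `dokchitser_padicValInt_minimalDiscriminantInt_eq_of_isogeny_of_not_dvd_degree_holds`.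
Unconditional; closes item 20708; BSD is not proved by this.
[cite: DokchitserDokchitser2015LocalInvariants, Thm. 5.1 (1) (arXiv:1208.5519 Thm. 19 (1)) with Table 1]
[cite: SilvermanAEC2009, Cor. VII.7.2 and Prop. VII.5.5] -/
theorem additiveKolyvaginRoad_dokchitserIsogenyMinimalDiscriminant_proof :
    Summit.BirchSwinnertonDyer.BirchSwinnertonDyer.Theses.AdditiveKolyvaginRoad.DokchitserIsogenyMinimalDiscriminant := by
  unfold Summit.BirchSwinnertonDyer.BirchSwinnertonDyer.Theses.AdditiveKolyvaginRoad.DokchitserIsogenyMinimalDiscriminant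
  exact Literature.NumberTheory.EllipticCurves.dokchitser_padicValInt_minimalDiscriminantInt_eq_of_isogeny_of_not_dvd_degree_holds

end Summit.BirchSwinnertonDyer.BirchSwinnertonDyer.Theorems.InputsSweep
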